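import Summits.RiemannHypothesis.RiemannHypothesis.Theses.LittlewoodRadar
import Literature.NumberTheory.LFunctions.NicolasMertensRH
import HarnessLib

/-!
# Route LittlewoodRadar (L52) — the declared residual `ThetaResidual` is RH-equivalent modulo the RH-free door
# (supports item stmt-RiemannHypothesis-24250; D-0179 split-or-blocker typing, route lead rlead-rh-LittlewoodRadar g0)

The route file declares the RESIDUAL `ThetaResidual` (stmt-24250) — some `H ≥ 16`, `η ∈ (0, 1/2]` with:
zeros of `ζ` in the strip above height `H` lie on the line (conj. 1 = RH ABOVE A HEIGHT), zeros below `H`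
lie on the line or at offset `≥ η` (conj. 2), and Schoenfeld's `θ`-envelope `|θ(x) − x| ≤ √x log²x/(8π)`
holds on the finite range `599 ≤ x ≤ exp(10⁹ log²H (1+|log η|)/η)` (conj. 3) — to be "RH-implied, never
staffed".  This file makes its status a KERNEL fact:

* `thetaResidual_of_RH : Schoenfeld1976_theta → RiemannHypothesis → ThetaResidual` (witness `H = 16,
  η = 1/2`; conj. 1–2 from the strip form of RH, conj. 3 = Schoenfeld 1976 Thm 10 (6.3) under RH).  The
  named fact `Schoenfeld1976_theta` is DISCHARGED in the tree (`SchoenfeldThetaLarge.Schoenfeld1976_theta_holds`),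
  so the implication is unconditional in the tree; it is kept in hypothesis position HERE only because that
  proof's closure carries `native_decide` certificate axioms (Mertens / low-sums checks) outside the
  Theorems whitelist {propext, Classical.choice, Quot.sound} (same convention as RobinFiniteE3Main,
  RobinSieveDetectors p470053);
* `rh_of_thetaResidual : PintzLocalisation → DoorOfPintz → ThetaResidual → RiemannHypothesis` — the route's
  own deciding theorem `Theses.LittlewoodRadar.closes` read through `Summit.RiemannHypothesis_iff`;
* `thetaResidual_iff_RH : Schoenfeld1976_theta → PintzLocalisation → DoorOfPintz → (ThetaResidual ↔ RiemannHypothesis)` — so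
  MODULO THE RH-FREE DOOR (items 24249 + 24251, Révész arXiv:2202.01837 Thm 5 made numeric + bookkeeping)
  the residual IS the Riemann Hypothesis: an EQUIV-grade piece, the summit in costume (census reader-22 /
  tribunal-lite 2026-08-29; D-0171/D-0179 BLOCKER = open summit-strength residual);
* `residual_iff_of_door` — the two-line propositional reason no RE-TYPING of the residual inside this
  architecture escapes: for ANY door `D` that holds and ANY residual `R` with `D → R → S` and `S → R`,
  `R ↔ S`.  A door+residual split of `S` whose door is a true RH-free theorem never distributes the
  difficulty of `S`: all of it sits in `R`.

Honest bookkeeping, 0 summit credit; nobody's proving target.  RH is not proved by any of this; nothing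
here bears on the truth of RH.
-/

-- D-0017: `Summit.RiemannHypothesis.RiemannHypothesis.…` duplicates the namespace BY DESIGN (single-problem summit).
set_option linter.dupNamespace false

noncomputable section

namespace Summit.RiemannHypothesis.RiemannHypothesis.Theorems.LittlewoodRadar

open Literature.NumberTheory.LFunctions
open Summit.RiemannHypothesis.RiemannHypothesis.Theses.LittlewoodRadar

/-- **`RH → ThetaResidual`, unconditionally.**  Witness `(H, η) = (16, 1/2)`: under RH every strip zero
is on the line (strip form `riemannHypothesis_iff_strip_holds`), so conj. 1 holds above any height and
conj. 2 by its left disjunct; conj. 3 is Schoenfeld's `θ`-envelope under RH for ALL `x ≥ 599`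
(named fact `Schoenfeld1976_theta`, discharged in the tree as `Schoenfeld1976_theta_holds`), a fortiori on
the finite range. [cite: Schoenfeld1976, Thm. 10 (6.3)] -/
theorem thetaResidual_of_RH (hS : Schoenfeld1976_theta) (hRH : _root_.RiemannHypothesis) :
    ThetaResidual := by
  have hstrip : RiemannHypothesisStrip := riemannHypothesis_iff_strip_holds.1 hRH
  refine ⟨16, 1 / 2, le_refl _, by norm_num, le_refl _, ?_, ?_, ?_⟩
  · intro s hs h0 h1 _
    exact hstrip s hs h0 h1
  · intro s hs h0 h1 _
    exact Or.inl (hstrip s hs h0 h1)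
  · intro x hx _
    exact hS hRH x hx

/-- **`ThetaResidual → RH` modulo the door** (`PintzLocalisation`, `DoorOfPintz`): given the residual's
`(H, η)`, a strip zero above height `H` is on the line by conj. 1; one of height `≤ H` is on the line or
has offset `≥ η` by conj. 2, and in the latter case the door `h2 h1` produces `x` in the table range with
the `θ`-envelope violated while conj. 3 asserts it. (The route's `closes` had this summit form up to
rev 3; since the D-0179 re-point it concludes the rung `ThetaRadarDoor`, so the logic is inlined here.)
[folklore] -/
theorem rh_of_thetaResidual (h1 : PintzLocalisation) (h2 : DoorOfPintz) (h3 : ThetaResidual) :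
    _root_.RiemannHypothesis := by
  -- (rev 2026-08-30: the route's `closes` is now the RUNG form `… → ThetaRadarDoor`; the former
  -- summit-form glue is inlined here with the door `h2 h1`.)
  rw [show _root_.RiemannHypothesis ↔ RiemannHypothesisStrip from riemannHypothesis_iff_strip_holds]
  intro s hs h0 h1'
  obtain ⟨H, η, hH, hη, hη2, hAbove, hFloor, hEnv⟩ := h3
  by_cases hhi : H < |s.im|
  · exact hAbove s hs h0 h1' hhi
  · rw [not_lt] at hhi
    rcases hFloor s hs h0 h1' hhi with h | h
    · exact h
    · exfalso
      obtain ⟨x, hx1, hx2, hlt⟩ := h2 h1 η H hη hη2 hH s hs h0 h1' hhi h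
      have hle := hEnv x hx1 hx2
      linarith

/-- **The declared residual is RH-EQUIVALENT modulo the RH-free door** (`PintzLocalisation`, `DoorOfPintz`):
`ThetaResidual ↔ RiemannHypothesis`.  This is the D-0179 typing of the route's BLOCKER: with the door in
hand the residual carries the whole summit; without it the route concludes nothing. [folklore] -/
theorem thetaResidual_iff_RH (hS : Schoenfeld1976_theta) (h1 : PintzLocalisation) (h2 : DoorOfPintz) :
    ThetaResidual ↔ _root_.RiemannHypothesis :=
  ⟨rh_of_thetaResidual h1 h2, thetaResidual_of_RH hS⟩

/-- The same with the summit constant `Summit.RiemannHypothesis`. [folklore] -/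
theorem thetaResidual_iff_summit (hS : Schoenfeld1976_theta) (h1 : PintzLocalisation) (h2 : DoorOfPintz) :
    ThetaResidual ↔ Summit.RiemannHypothesis :=
  (thetaResidual_iff_RH hS h1 h2).trans Summit.RiemannHypothesis_iff.symm

/-- **Why no re-typing of the residual helps** (propositional): if a door `D` holds, the split is
`D → R → S`, and the residual is `S`-implied, then `R ↔ S`.  Every door+residual decomposition of a
statement `S` through a TRUE door concentrates all of `S` in the residual. [folklore] -/
theorem residual_iff_of_door {D R S : Prop} (hD : D) (hsplit : D → R → S) (himp : S → R) : R ↔ S :=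
  ⟨hsplit hD, himp⟩

/-- Instance of `residual_iff_of_door` for this route, packaging the door as ONE proposition
`PintzLocalisation ∧ DoorOfPintz`. [folklore] -/
theorem thetaResidual_iff_of_door (hS : Schoenfeld1976_theta) (hdoor : PintzLocalisation ∧ DoorOfPintz) :
    ThetaResidual ↔ _root_.RiemannHypothesis :=
  residual_iff_of_door hdoor (fun d r => rh_of_thetaResidual d.1 d.2 r) (thetaResidual_of_RH hS)

end Summit.RiemannHypothesis.RiemannHypothesis.Theorems.LittlewoodRadar

end
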